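import Mathlib
import Literature.Analysis.FluidPDE.CompressibleEulerImplosionBulkEnvelopeWindow2
import Summits.AtomisticToContinuum.HydrodynamicLimit.Theorems.ImplosionDichotomyDenseExcursionSonicCavityDefsC
import Summits.AtomisticToContinuum.HydrodynamicLimit.Theorems.ImplosionDichotomyDenseExcursionSonicPinnedProfileCentreD

/-!
# The pinned BCG profile: the eight certified bulk envelopes `CavityTubeBulk` on `[log(1/100), −7/10]`
# (crux `DenseExcursion`, line `sonic-cavity-renewal`, brick `bulk_envelopes_certified` of stub `stub_boxPackage`)

Helper file (`--supports stmt-AtomisticToContinuum-12586`) for the registered stub `stub_boxPackage` of the line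
`sonic-cavity-renewal` (crux `Summit.AtomisticToContinuum.HydrodynamicLimit.Theses.ImplosionDichotomy.DenseExcursion`):
clause (g) `CavityTubeBulk` (`…SonicCavityDefsC`: pointwise envelopes on the bulk `log(1/100) ≤ x ≤ −7/10` of the
eight quantities `G, G′, H, H′, |b₋₊||b₊₋|/(2S), R′, b₊₊/c₊ + b₋₋/|c₋|, 1/c₊ + 1/|c₋|` consumed by the weighted-Levinson
transport of the acoustic amplitude ratio) FOR THE PINNED PROFILE of `exists_pinnedProfile_centre_expansion`
(`…SonicPinnedProfileCentreD`). On the bulk `ζ = c eˣ ≤ c/2 ≤ 23/100` lies deep inside the certified disc of the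
centre series, where the profile IS the series profile `(Wser r c, Sser r c)` (the identification clause of
`exists_pinnedProfile_centre_expansion`, valid on the open set `c eˣ < 17/50`); for the series profile the eight
envelopes are the kernel-certified Literature theorem `OriginSeries.CentreW2.bulk_envelopes_window2`
(`Literature/…/CompressibleEulerImplosionBulkEnvelopeWindow2.lean`: Taylor models in `ζ` with the `r`-uniform interval
coefficients `bndsW2`, seventeen polynomial sign conditions checked by `posOn` on three `(c, ζ)`-pieces, `decide +kernel`).

* `bulk_envelopes_series` — `CavityTubeBulk r (Wser r c) (Sser r c)` for every `r` in the shooting window and every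
  `c ∈ [17/50, 23/50]`;
* `bulk_envelopes_certified` (registered) — all clauses of `exists_pinnedProfile_centre_expansion` AND `CavityTubeBulk r W S`
  for the witness.

Sources: Buckmaster–Cao-Labora–Gómez-Serrano 2025, Thm 1.1, Prop. 2.5, App. B.
-/

noncomputable section

open Set Filter Topology

namespace Summit.AtomisticToContinuum.HydrodynamicLimit.Theorems.SonicCavityRenewal

open Literature.Analysis.FluidPDE.BuckmasterCaolaboraGomezserrano2025
open Literature.Analysis.FluidPDE.BuckmasterCaolaboraGomezserrano2025.OriginSeries.CentreW2
open Summit.AtomisticToContinuum.HydrodynamicLimit.Theorems.R2OneModeTwoConditions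

/-- **The eight bulk envelopes of the series profile**: `CavityTubeBulk r (Wser r c) (Sser r c)` for every speed `r` in the
shooting window `[13890041/12500000, 697/625]` and every sonic scale `c ∈ [17/50, 23/50]`.
[cite: BuckmasterCaolaboraGomezserrano2025, Prop. 2.5, App. B] -/
theorem bulk_envelopes_series : ∀ (r c : ℝ), (13890041 / 12500000 : ℝ) ≤ r → r ≤ 697 / 625 → 17 / 50 ≤ c → c ≤ 23 / 50 →
    CavityTubeBulk r (OriginSeries.CentreW2.Wser r c) (OriginSeries.CentreW2.Sser r c) := by
  intro r c h1 h2 h3 h4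
  have hr : r ∈ Set.Icc ((13890041/12500000 : ℚ) : ℝ) ((697/625 : ℚ) : ℝ) := by
    refine ⟨?_, ?_⟩ <;> push_cast <;> linarith
  unfold CavityTubeBulk
  intro x hx1 hx2
  have h := bulk_envelopes_window2 hr ⟨h3, h4⟩ x hx1 hx2
  unfold bulkG bulkH bulkR bulkBmp bulkBpm bulkCp bulkCm bulkBpp bulkBmm
  exact h

/-- **Brick `bulk_envelopes_certified` of stub `stub_boxPackage` (line `sonic-cavity-renewal`): THE PINNED PROFILE WITH ITS
CERTIFIED BULK ENVELOPES.** There are a speed `r` in the shooting window, a sonic scale `c ∈ [17/50, 23/50]` and a profile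
`(W, S)` with all the clauses of `exists_pinnedProfile_centre_expansion` (monatomic profile, equations in original form,
sonic point at `0` with transversality and repulsivity, analyticity, the series identification on `c eˣ < 17/50`, the centre
expansion (d) on `x ≤ −1/3`) AND the eight bulk envelopes `CavityTubeBulk r W S` on `[log(1/100), −7/10]`.
[cite: BuckmasterCaolaboraGomezserrano2025, Thm 1.1, Prop. 2.5, App. B] -/
theorem bulk_envelopes_certified : ∃ (r c : ℝ) (W S : ℝ → ℝ), ((13890041 / 12500000 : ℝ) ≤ r ∧ r ≤ 697 / 625) ∧ IsMonatomicProfile r W S ∧ OrigProfileEqs r W S ∧ W 0 + S 0 = 1 ∧ (∀ x, x < 0 → 1 < W x + S x) ∧ (∀ x, 0 < x → W x + S x < 1) ∧ deriv W 0 + deriv S 0 = -(2 - r - Real.sqrt (2 * (r - 1))) ∧ deriv W 0 + deriv S 0 ≤ -(2 / 5) ∧ W 0 = (r - Real.sqrt (r ^ 2 - 6 * r + 6)) / 2 ∧ AnalyticAt ℝ W 0 ∧ AnalyticAt ℝ S 0 ∧ (17 / 50 ≤ c ∧ c ≤ 23 / 50) ∧ (∀ x, c * Real.exp x < 17 / 50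 → W x = OriginSeries.CentreW2.Wser r c x ∧ S x = OriginSeries.CentreW2.Sser r c x) ∧ CavityTubeBulk r W S ∧ ∃ W₂ s₀ s₂ : ℝ, |W₂| ≤ 1 / 10 ∧ 7 / 10 ≤ s₀ ∧ s₀ ≤ 1 ∧ |s₂| ≤ 1 / 10 ∧ ∀ x, x ≤ -(1 / 3) → |W x - (r - 1) - W₂ * Real.exp (2 * x)| ≤ 2 * Real.exp (4 * x) ∧ |deriv W x - 2 * W₂ * Real.exp (2 * x)| ≤ 2 * Real.exp (4 * x) ∧ |deriv (deriv W) x - 4 * W₂ * Real.exp (2 * x)| ≤ 2 * Real.exp (4 * x) ∧ |Real.exp x * S x - s₀ - s₂ * Real.exp (2 * x)| ≤ 2 * Real.exp (4 * x) ∧ |deriv (fun y => Real.exp y * S y) x - 2 * s₂ * Real.exp (2 * x)| ≤ 2 * Real.exp (4 * x) ∧ |deriv (deriv (fun y => Real.exp y * S y)) x - 4 * s₂ * Real.exp (2 * x)| ≤ 2 * Real.exp (4 * x) := by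
  obtain ⟨r, c, W, S, hr, hmono, heqs, h0, hneg, hpos, hκ', hκ, hW0, haW, haS, ⟨hclb, hcub⟩, hident, W₂, s₀, s₂, hW2, hs0a,
    hs0b, hs2, hd⟩ := exists_pinnedProfile_centre_expansion
  refine ⟨r, c, W, S, hr, hmono, heqs, h0, hneg, hpos, hκ', hκ, hW0, haW, haS, ⟨hclb, hcub⟩, hident, ?_, W₂, s₀, s₂, hW2,
    hs0a, hs0b, hs2, hd⟩
  -- the bulk envelopes of the series profile, transported through the open set `c eˣ < 17/50`
  have hseries := bulk_envelopes_series r c hr.1 hr.2 hclb hcub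
  have hUopen : IsOpen {y : ℝ | c * Real.exp y < 17 / 50} :=
    isOpen_lt (continuous_const.mul Real.continuous_exp) continuous_const
  have hWev : ∀ y : ℝ, c * Real.exp y < 17 / 50 → W =ᶠ[𝓝 y] Wser r c := fun y hy => by
    filter_upwards [hUopen.mem_nhds hy] with z hz using (hident z hz).1
  have hSev : ∀ y : ℝ, c * Real.exp y < 17 / 50 → S =ᶠ[𝓝 y] Sser r c := fun y hy => by
    filter_upwards [hUopen.mem_nhds hy] with z hz using (hident z hz).2
  have hU : ∀ y : ℝ, y ≤ -(7 / 10) → c * Real.exp y < 17 / 50 := fun y hy => by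
    have : Real.exp y < 1 / 2 := (Real.exp_le_exp.mpr hy).trans_lt exp_neg_seven_tenths_lt
    nlinarith [Real.exp_pos y]
  unfold CavityTubeBulk
  intro x hx1 hx2
  have hxU := hU x hx2
  -- pointwise identifications at `x`
  have eW : W x = Wser r c x := (hWev x hxU).eq_of_nhds
  have edW : deriv W x = deriv (Wser r c) x := (hWev x hxU).deriv_eq
  have eS : S x = Sser r c x := (hSev x hxU).eq_of_nhds
  have edS : deriv S x = deriv (Sser r c) x := (hSev x hxU).deriv_eq
  -- the composite quantities agree near `x`
  have hG : bulkG W S =ᶠ[𝓝 x] bulkG (Wser r c) (Sser r c) := by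
    filter_upwards [hUopen.mem_nhds hxU] with y hy
    unfold bulkG bulkBmp bulkCp
    rw [(hWev y hy).eq_of_nhds, (hWev y hy).deriv_eq, (hSev y hy).eq_of_nhds, (hSev y hy).deriv_eq]
  have hH : bulkH W S =ᶠ[𝓝 x] bulkH (Wser r c) (Sser r c) := by
    filter_upwards [hUopen.mem_nhds hxU] with y hy
    unfold bulkH bulkBpm bulkCm
    rw [(hWev y hy).eq_of_nhds, (hWev y hy).deriv_eq, (hSev y hy).eq_of_nhds, (hSev y hy).deriv_eq]
  have hR : bulkR r W S =ᶠ[𝓝 x] bulkR r (Wser r c) (Sser r c) := by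
    filter_upwards [hUopen.mem_nhds hxU] with y hy
    unfold bulkR
    rw [(hWev y hy).eq_of_nhds, (hWev y hy).deriv_eq, (hSev y hy).eq_of_nhds, (hSev y hy).deriv_eq]
  have eBmp : bulkBmp W S x = bulkBmp (Wser r c) (Sser r c) x := by unfold bulkBmp; rw [edW, eS, edS]
  have eBpm : bulkBpm W S x = bulkBpm (Wser r c) (Sser r c) x := by unfold bulkBpm; rw [edW, eS, edS]
  have eCp : bulkCp W S x = bulkCp (Wser r c) (Sser r c) x := by unfold bulkCp; rw [eW, eS]
  have eCm : bulkCm W S x = bulkCm (Wser r c) (Sser r c) x := by unfold bulkCm; rw [eW, eS]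
  have eBpp : bulkBpp r W S x = bulkBpp r (Wser r c) (Sser r c) x := by unfold bulkBpp; rw [edW, eW, eS, edS]
  have eBmm : bulkBmm r W S x = bulkBmm r (Wser r c) (Sser r c) x := by unfold bulkBmm; rw [edW, eW, eS, edS]
  rw [hG.eq_of_nhds, hG.deriv_eq, hH.eq_of_nhds, hH.deriv_eq, hR.deriv_eq, eBmp, eBpm, eCp, eCm, eBpp, eBmm, eS]
  exact hseries x hx1 hx2

end Summit.AtomisticToContinuum.HydrodynamicLimit.Theorems.SonicCavityRenewal

end
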